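import Summits.ABC.IUTFork.Conditional.WRowLicenceTripleEventuallySharp
import Literature.IUT.LogVolume.Corollary22LegendreDeepAdmissiblePairs
import HarnessLib

/-!
# R-W WINDOW numerics («W:HEX-UNIFORM-K», part U1): the HEX family `λ_k = 1/2 + 2/7^k` at EVERY `k ≥ 1`, UNIFORMLY in `k` — the hull
# licence S_H HOLDS at EVERY genuine Θ-volume datum over `(ratPoint λ_k, l)` for every prime `l` beyond an EXPLICIT `k`-bound

PROOF-ONLY file (D-0012; 0 definitions, 0 `Prop` facts, no instance, no notation) of the abc-iut cell — branch C certificate seat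
abc-iut-C-cert-1 (gen 9), row «W:HEX-UNIFORM-K» (abc-iut-plan C-R122 (a), KEY wake/KEY-abc-iut-C-cert-1-HEXUNIFORMK.md), after the 24
numeric axes `k = 1…24` (files `WRowHexLamSeven<K>{RefutedBand,AllLevels}`, FINDINGS §T.8–§T.11). TAKES NO SIDE on [IUTchIII] Cor. 3.12
(S. Mochizuki, *Inter-universal Teichmüller theory III*, Cor. 3.12 p. 173–174; Step (xi-f) p. 184) or on any author; «inhabited as typed» ≠
«asserted in print».

KEY REMARK (as in every numeric HEX file): `λ_k = (7^k + 4)/(2·7^k)` is the Frey–Legendre point `a/c` of the abc triple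
`(7^k + 4) + (7^k − 4) = 2·7^k` — both summands odd and differing by `8`, hence coprime — so abc-iut-C-cert-2's GENERIC eventual sockets for
ALL abc triples (`WRow.hcell_triple_of_sq_lt` / `WRow.licence_triple_of_primePow_lt`, `Conditional/WRowLicenceTripleEventuallySharp`, over
abc-iut-W-row-1's `WRow.licence_triple_unconditional`) apply at a SYMBOLIC `k`; nothing of theirs is restated. WHAT IS PROVED (namespace
`Summit.ABC.IUTFork.Conditional`), all for symbolic `k ≥ 1`:
* generic term-mode wrappers for ANY abc triple (`WRow.licence_triple_of_sq_lt`, `WRow.exists_qPinned_and_hull_triple_of_sq_lt` here,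
  `WRow.exists_qPinned_and_hull_triple_of_primePow_lt` in part U1 (ii) — companions of abc-iut-C-cert-2's `WRow.licence_triple_of_primePow_lt`);
  `isABCTriple_hexK` (`IsABCTriple (7^k+4) (7^k−4) (2·7^k)`), `lamSeven_eq_hexK` (`1/2 + 2/7^k = (7^k+4)/(2·7^k)` in `ℚ`), `jInv_hexK_ne`
  (`j(λ_k) ≠ 1728`: `j = 1728` forces `(λ+1)(λ−2)(2λ−1) = 0`, impossible for `1/2 < λ_k ≤ 1/2 + 2/7`);
* **`WRow.licence_lamSeven_allK_of_sq_lt`** — for EVERY `k ≥ 1` and EVERY prime `l` with `16·abc_k < l²`, `abc_k = (7^k+4)(7^k−4)·2·7^k`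
  (i.e. `l² > 32·7^k·(7^{2k} − 16)`, so `l > 4·√(abc_k)`): at every genuine Θ-volume datum `T` over `(ratPoint λ_k, l)` and every pair of
  realising Θ- and q-ideles, abc-iut-c312-1's `Thm311ToCor312.Licence` HOLDS at abc-iut-c312-7's `settingPrVolSharp …` (the socket's conclusion
  VERBATIM), + **`WRow.exists_qPinned_and_hull_lamSeven_allK_of_sq_lt`** (branch C's per-datum antecedent «∃ ρ qK, QPinned ∧ PilotKummerCompatHull»);
* (part U1 (ii), `WRowHexLamSevenAllKEventuallySharp.lean`) **`WRow.licence_lamSeven_allK_of_primePow_lt`** — the SHARP form: every prime `l ≥ 5` with `p < l ∧ 4·p^{⌊v_p(abc_k)/2⌋} < l` for every odd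
  prime `p ∣ abc_k` (the socket's per-prime hypothesis LEFT AS A HYPOTHESIS on `l`, verbatim — uniform in `k`; each numeric axis `k`
  discharges it from its `WRowHexLamSevenTriples<K>` prelude), + the `exists_qPinned_and_hull` twin;
* **`WRow.licence_lamSeven_allK_sharp`** — the same with the `p = 7` part made explicit: `7 < l`, `4·7^{⌊k/2⌋} < l`, and for every prime
  `p ∣ (7^k+4)(7^k−4)`: `p < l ∧ 4·p^{⌊v_p((7^k+4)(7^k−4))/2⌋} < l` (`v_7(abc_k) = k`, `v_p(abc_k) = v_p((7^k+4)(7^k−4))` for the other odd `p`;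
  lemma `hexK_bad_of_split`), + twin.
READING (neutral; numbers, not adjectives): for every `k ≥ 1` the HEX axis `k` is INHABITED-TRUE AS TYPED ∀T at every prime `l` with
`l² > 16·abc_k`, and, sharper, at every prime `l > max(7, 4·7^{⌊k/2⌋}, p, 4·p^{⌊v_p/2⌋})` over the odd primes `p ∣ 7^{2k} − 16`; the exact per-axis
thresholds `L⁺(k)` of the numeric files (`k ≤ 24`) are far below these closed forms and remain the R-W table's business. HONEST SCOPE: OUR sharp
containers and Dupuy–Hilado's typed (Ind1)/(Ind2); STRONGER-THAN-PRINT hull reading; admissibility / Szpiro-badness / (P6) of `(ratPoint λ_k, l)`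
and NON-EMPTINESS of the datum type are NOT claimed (a «∀ T» statement is vacuous if no datum exists); nothing about the printed inequality or any
author's intended hull; typed ≠ proved; instantiated ≠ endorsed; no abc claim.
[cite: Mochizuki2012, IUTchI Def. 3.1 (b),(c) pp. 61–62, Ex. 3.2 (iv) p. 71; IUTchIII Cor. 3.12 Step (xi-d) p. 183, (xi-f) p. 184; IUTchIV Prop. 1.2 (i)(ii) p. 10, Prop. 1.4 (ii) p. 13, Cor. 2.2 (ii) proof (P5) p. 46] [cite: DupuyHilado2025, §3.3, §3.4, §4.9, §4.12] [claim: Mochizuki2012, status: disputed] for every IUT sentence quoted.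
-/

noncomputable section

open Set Function Metric NumberField IsDedekindDomain

namespace Summit.ABC.IUTFork.Conditional

open Thm311 Thm311.Real Cor312 Cor312Vol Cor312Prov Literature.IUT.LogThetaLattice Literature.IUT.LogVolume
  Literature.IUT.HodgeTheaters Literature.IUT.LogVolume.Cor22
open Literature.NumberTheory.NumberFields Literature.NumberTheory.GaloisRepresentations.Ultrametric
open Literature.NumberTheory.DiophantineGeometry Literature.NumberTheory.DiophantineGeometry.GenEll

/-! ## §0. The HEX triple at a symbolic `k` -/

/-- `7 ∤ 7^k + 4` and `7 ∤ 7^k − 4` for `k ≥ 1`. [folklore] -/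
private theorem seven_not_dvd_hexK {k : ℕ} (hk : 1 ≤ k) : ¬ 7 ∣ 7 ^ k + 4 ∧ ¬ 7 ∣ 7 ^ k - 4 := by
  have h7 : 7 ∣ 7 ^ k := dvd_pow_self 7 (by omega)
  have hle : 7 ≤ 7 ^ k := by simpa using Nat.pow_le_pow_right (by norm_num : 1 ≤ 7) hk
  refine ⟨fun h => ?_, fun h => ?_⟩
  · have : 7 ∣ 4 := (Nat.dvd_add_right h7).1 h
    omega
  · obtain ⟨m, hm⟩ := h
    obtain ⟨n, hn⟩ := h7
    omega

/-- **`(7^k + 4) + (7^k − 4) = 2·7^k` is an abc triple for every `k ≥ 1`**: both summands are odd and differ by `8`, so their gcd divides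
`8` and is odd. [folklore] -/
theorem isABCTriple_hexK {k : ℕ} (hk : 1 ≤ k) : IsABCTriple (7 ^ k + 4) (7 ^ k - 4) (2 * 7 ^ k) := by
  have hle : 7 ≤ 7 ^ k := by simpa using Nat.pow_le_pow_right (by norm_num : 1 ≤ 7) hk
  refine ⟨by omega, by omega, by omega, ?_⟩
  have hodd : Odd (7 ^ k - 4) := by
    have h7 : Odd (7 ^ k) := Odd.pow (by decide : Odd 7)
    exact Nat.Odd.sub_even (by omega) h7 (by decide)
  have h8 : Nat.Coprime 8 (7 ^ k - 4) := by
    have : Nat.Coprime (2 ^ 3) (7 ^ k - 4) :=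
      (Nat.coprime_pow_left_iff (by norm_num) _ _).mpr (Nat.coprime_two_left.mpr hodd)
    simpa using this
  have hsub : 7 ^ k + 4 - (7 ^ k - 4) = 8 := by omega
  have key : Nat.gcd (7 ^ k + 4 - (7 ^ k - 4)) (7 ^ k - 4) = Nat.gcd (7 ^ k + 4) (7 ^ k - 4) :=
    Nat.gcd_sub_self_left (by omega)
  rw [hsub] at key
  rw [Nat.Coprime, ← key]
  exact h8

/-- `λ_k = 1/2 + 2/7^k = (7^k + 4)/(2·7^k)`. [folklore] -/
theorem lamSeven_eq_hexK (k : ℕ) : (2 : ℚ)⁻¹ + 2 / 7 ^ k = ((7 ^ k + 4 : ℕ) : ℚ) / ((2 * 7 ^ k : ℕ) : ℚ) := by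
  have h7 : (7 : ℚ) ^ k ≠ 0 := pow_ne_zero _ (by norm_num)
  push_cast
  field_simp
  ring

/-- **`j(λ_k) ≠ 1728` for every `k ≥ 1`.** `j(λ) = 2⁸(λ²−λ+1)³/(λ²(λ−1)²) = 1728` forces `((λ+1)(λ−2)(2λ−1))² = 0` (the identity of
`Literature/IUT/LogVolume/Corollary22CMLocus`), and `λ_k = 1/2 + 2/7^k` has `λ_k > 0`, `λ_k ≤ 1/2 + 2/7 < 2`, `2λ_k − 1 = 4/7^k ≠ 0`.
[cite: SilvermanAEC2009, Prop. III.1.7(b)] -/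
theorem jInv_hexK_ne {k : ℕ} (hk : 1 ≤ k) : Cor22.jInv (((7 ^ k + 4 : ℕ) : ℚ) / ((2 * 7 ^ k : ℕ) : ℚ)) ≠ 1728 := by
  rw [← lamSeven_eq_hexK k]
  obtain ⟨h0, h1⟩ := Cor22.lamSeven_ne hk
  have h7k : (7 : ℚ) ≤ 7 ^ k := by exact_mod_cast Nat.le_self_pow (by omega : k ≠ 0) 7
  have hfrac : (2 : ℚ) / 7 ^ k ≤ 2 / 7 := div_le_div_of_nonneg_left (by norm_num) (by norm_num) h7k
  have hpos : (0 : ℚ) < 2 / 7 ^ k := by positivity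
  generalize ht : (2 : ℚ)⁻¹ + 2 / 7 ^ k = t at h0 h1 ⊢
  have htlo : (2 : ℚ)⁻¹ < t := by rw [← ht]; linarith
  have hthi : t ≤ 2⁻¹ + 2 / 7 := by rw [← ht]; linarith
  intro h
  unfold Cor22.jInv at h
  have hden : t ^ 2 * (t - 1) ^ 2 ≠ 0 := mul_ne_zero (pow_ne_zero _ h0) (pow_ne_zero _ (sub_ne_zero.mpr h1))
  rw [div_eq_iff hden] at h
  have hsq : ((t + 1) * (t - 2) * (2 * t - 1)) ^ 2 = 0 := by linear_combination (1 / 64 : ℚ) * h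
  have h3 : (t + 1) * (t - 2) * (2 * t - 1) = 0 := pow_eq_zero_iff (two_ne_zero) |>.mp hsq
  rcases mul_eq_zero.mp h3 with h4 | h4
  · rcases mul_eq_zero.mp h4 with h5 | h5
    · linarith
    · linarith
  · linarith


/-! ## §0b. Two generic wrappers for ANY abc triple (term-mode companions of abc-iut-C-cert-2's `WRow.licence_triple_of_primePow_lt`) -/

/-- **S_H for ANY abc triple (`j ≠ 1728`) at every prime `l` with `16·abc < l²`**: abc-iut-W-row-1's `WRow.licence_triple_unconditional` at
abc-iut-C-cert-2's `WRow.hcell_triple_of_sq_lt` (envelope exponents `⌊v_p(abc)/2⌋`) — the licence-level companion of their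
`WRow.cor312Of_triple_of_sq_lt`, conclusion VERBATIM. [cite: Mochizuki2012, IUTchI Def. 3.1 (b),(c) pp. 61–62, Ex. 3.2 (iv) p. 71; IUTchIII Cor. 3.12 Step (xi-d) p. 183, (xi-f) p. 184; IUTchIV Prop. 1.2 (i)(ii) p. 10, Prop. 1.4 (ii) p. 13, Cor. 2.2 (ii) proof (P5) p. 46] [cite: DupuyHilado2025, §3.3, §3.4, §4.9, §4.12] [claim: Mochizuki2012, status: disputed] -/
theorem WRow.licence_triple_of_sq_lt {a b c l : ℕ} (habc : IsABCTriple a b c) (hj1728 : Cor22.jInv ((a : ℚ) / c) ≠ 1728)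
    (hl : l.Prime) (hbig : 16 * (a * b * c) < l ^ 2) (T : Cor22.ThetaVolumeDatumAt (ratPoint ((a : ℚ) / c)) l) :
    letI := T.instFieldF; letI := T.instNumberFieldF; letI := T.instAlgebraF; letI := T.instFieldK
    letI := T.instNumberFieldK; letI := T.instAlgebraK; letI := T.instFieldFbar; letI := T.instAlgebraFbar
    letI := T.instAlgebraKFbar; letI := T.instIsElliptic
    ∀ {logv : PadicLogs T.K} (hlog : LogvAnalytic logv) (M : Type) [Field M] [NumberField M]
      (archPk : ∀ (j : (thetaIndex (pilotDataOfK T.D T.K)).Label) (vQ : (thetaIndex (pilotDataOfK T.D T.K)).VQ),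
        Set ((logShellsDH (pilotDataOfK T.D T.K) logv).Packet j vQ))
      (archSub : ∀ (j : (thetaIndex (pilotDataOfK T.D T.K)).Label) (v : (thetaIndex (pilotDataOfK T.D T.K)).V),
        Set ((logShellsDH (pilotDataOfK T.D T.K) logv).Packet j ((thetaIndex (pilotDataOfK T.D T.K)).over v)))
      (Ψ : ℤ → ∀ v : (thetaIndex (pilotDataOfK T.D T.K)).V, v ∈ (thetaIndex (pilotDataOfK T.D T.K)).Vbad →
        Set ((logShellsDH (pilotDataOfK T.D T.K) logv).StarPacket v))
      (act : ℤ → ∀ v : (thetaIndex (pilotDataOfK T.D T.K)).V, v ∈ (thetaIndex (pilotDataOfK T.D T.K)).Vbad →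
        (logShellsDH (pilotDataOfK T.D T.K) logv).StarPacket v → Module.End ℚ ((logShellsDH (pilotDataOfK T.D T.K) logv).StarPacket v))
      (Mmod : ℤ → ∀ j : (thetaIndex (pilotDataOfK T.D T.K)).LabelStar, Set ((logShellsDH (pilotDataOfK T.D T.K) logv).GlobalPacket j.1))
      (region : ℤ → ∀ j : (thetaIndex (pilotDataOfK T.D T.K)).LabelStar, FinDivisor M → ∀ vQ : (thetaIndex (pilotDataOfK T.D T.K)).VQ,
        Set ((logShellsDH (pilotDataOfK T.D T.K) logv).Packet j.1 vQ))
      (n : ℤ) {HT : Type} {LogLink : HT → HT → Type} {IsFull : ∀ {s t : HT}, LogLink s t → Prop}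
      (lat : LGPGaussianLogThetaLattice LogLink IsFull)
      {Frd : Type} {IsoF : Frd → Frd → Type} {Ob : Frd → Type} {realify : Frd → Frd} {Strip : Type}
      {IsoS : Strip → Strip → Type} {Mv : ∀ v : (thetaIndex (pilotDataOfK T.D T.K)).V, v ∈ (thetaIndex (pilotDataOfK T.D T.K)).Vbad → Type}
      [∀ v h, Monoid (Mv v h)]
      (sig : GlobalLGPFrobenioidSignature (thetaIndex (pilotDataOfK T.D T.K)).lstar (thetaIndex (pilotDataOfK T.D T.K)).V
        (· ∈ (thetaIndex (pilotDataOfK T.D T.K)).Vbad) Frd IsoF Ob realify Strip IsoS Mv)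
      (split : SplittingMonoids Mv) {ObΔ : Type} {N : ∀ v : (thetaIndex (pilotDataOfK T.D T.K)).V, v ∈ (thetaIndex (pilotDataOfK T.D T.K)).Vbad → Type}
      [∀ v h, Monoid (N v h)] (qData : QPilotData ObΔ N)
      (tq : ∀ (pp : Nat.Primes) (x : (thetaIndex (pilotDataOfK T.D T.K)).Fibre (.inr pp)),
        haveI : Fact (pp : ℕ).Prime := ⟨pp.2⟩; kOf (pilotDataOfK T.D T.K) pp.1 x)
      (t : ∀ (pp : Nat.Primes) (_ : Fin (pilotDataOfK T.D T.K).lstar) (x : (thetaIndex (pilotDataOfK T.D T.K)).Fibre (.inr pp)),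
        haveI : Fact (pp : ℕ).Prime := ⟨pp.2⟩; kOf (pilotDataOfK T.D T.K) pp.1 x)
      (htq0 : ∀ pp x, tq pp x ≠ 0)
      (htq1 : ∀ (pp : Nat.Primes) (x : (thetaIndex (pilotDataOfK T.D T.K)).Fibre (.inr pp)),
        haveI : Fact (pp : ℕ).Prime := ⟨pp.2⟩; placeOf (pilotDataOfK T.D T.K) pp.1 x ∉ (pilotDataOfK T.D T.K).S → ‖tq pp x‖ = 1)
      (_ht0 : ∀ pp i x, t pp i x ≠ 0)
      (_ht : ∀ (pp : Nat.Primes) (i : Fin (pilotDataOfK T.D T.K).lstar) (x : (thetaIndex (pilotDataOfK T.D T.K)).Fibre (.inr pp)),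
        haveI : Fact (pp : ℕ).Prime := ⟨pp.2⟩
        Real.log ‖t pp i x‖ = -((pilotDataOfK T.D T.K).thetaPilot i (placeOf (pilotDataOfK T.D T.K) pp.1 x)) *
          logNorm T.K (placeOf (pilotDataOfK T.D T.K) pp.1 x) / localDegree T.K (placeOf (pilotDataOfK T.D T.K) pp.1 x))
      (_htq : ∀ (pp : Nat.Primes) (x : (thetaIndex (pilotDataOfK T.D T.K)).Fibre (.inr pp)),
        haveI : Fact (pp : ℕ).Prime := ⟨pp.2⟩
        Real.log ‖tq pp x‖ = -((pilotDataOfK T.D T.K).qPilot (placeOf (pilotDataOfK T.D T.K) pp.1 x)) *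
          logNorm T.K (placeOf (pilotDataOfK T.D T.K) pp.1 x) / localDegree T.K (placeOf (pilotDataOfK T.D T.K) pp.1 x)),
      Thm311ToCor312.Licence
        (settingPrVolSharp (pilotDataOfK T.D T.K) hlog M archPk archSub Ψ act Mmod region n lat sig split qData tq t htq0 htq1) :=
  WRow.licence_triple_unconditional habc hj1728 T (fun p => (a * b * c).factorization p / 2)
    (fun p => (a * b * c).factorization p / 2) (WRow.hcell_triple_of_sq_lt habc hl hbig)

/-- **«∃ ρ qK, QPinned ∧ PilotKummerCompatHull» for ANY abc triple (`j ≠ 1728`) at every prime `l` with `16·abc < l²`** (any columns; every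
pair of realising ideles): `WRow.exists_qPinned_and_hull_triple_unconditional` at `WRow.hcell_triple_of_sq_lt`.
[cite: Mochizuki2012, IUTchIII Cor. 3.12 Step (xi-d) p. 183, (xi-f) p. 184] [cite: DupuyHilado2025, §4.9] [claim: Mochizuki2012, status: disputed] -/
theorem WRow.exists_qPinned_and_hull_triple_of_sq_lt {a b c l : ℕ} (habc : IsABCTriple a b c)
    (hj1728 : Cor22.jInv ((a : ℚ) / c) ≠ 1728) (hl : l.Prime) (hbig : 16 * (a * b * c) < l ^ 2)
    (T : Cor22.ThetaVolumeDatumAt (ratPoint ((a : ℚ) / c)) l) :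
    letI := T.instFieldF; letI := T.instNumberFieldF; letI := T.instAlgebraF; letI := T.instFieldK
    letI := T.instNumberFieldK; letI := T.instAlgebraK; letI := T.instFieldFbar; letI := T.instAlgebraFbar
    letI := T.instAlgebraKFbar; letI := T.instIsElliptic
    ∀ {logv : PadicLogs T.K} (hlog : LogvAnalytic logv) (M : Type) [Field M] [NumberField M]
      (archPk : ∀ (j : (thetaIndex (pilotDataOfK T.D T.K)).Label) (vQ : (thetaIndex (pilotDataOfK T.D T.K)).VQ),
        Set ((logShellsDH (pilotDataOfK T.D T.K) logv).Packet j vQ))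
      (archSub : ∀ (j : (thetaIndex (pilotDataOfK T.D T.K)).Label) (v : (thetaIndex (pilotDataOfK T.D T.K)).V),
        Set ((logShellsDH (pilotDataOfK T.D T.K) logv).Packet j ((thetaIndex (pilotDataOfK T.D T.K)).over v)))
      (Ψ : ℤ → ∀ v : (thetaIndex (pilotDataOfK T.D T.K)).V, v ∈ (thetaIndex (pilotDataOfK T.D T.K)).Vbad →
        Set ((logShellsDH (pilotDataOfK T.D T.K) logv).StarPacket v))
      (act : ℤ → ∀ v : (thetaIndex (pilotDataOfK T.D T.K)).V, v ∈ (thetaIndex (pilotDataOfK T.D T.K)).Vbad →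
        (logShellsDH (pilotDataOfK T.D T.K) logv).StarPacket v → Module.End ℚ ((logShellsDH (pilotDataOfK T.D T.K) logv).StarPacket v))
      (Mmod : ℤ → ∀ j : (thetaIndex (pilotDataOfK T.D T.K)).LabelStar, Set ((logShellsDH (pilotDataOfK T.D T.K) logv).GlobalPacket j.1))
      (region : ℤ → ∀ j : (thetaIndex (pilotDataOfK T.D T.K)).LabelStar, FinDivisor M → ∀ vQ : (thetaIndex (pilotDataOfK T.D T.K)).VQ,
        Set ((logShellsDH (pilotDataOfK T.D T.K) logv).Packet j.1 vQ))
      (n : ℤ) {HT : Type} {LogLink : HT → HT → Type} {IsFull : ∀ {s t : HT}, LogLink s t → Prop}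
      (lat : LGPGaussianLogThetaLattice LogLink IsFull)
      {Frd : Type} {IsoF : Frd → Frd → Type} {Ob : Frd → Type} {realify : Frd → Frd} {Strip : Type}
      {IsoS : Strip → Strip → Type} {Mv : ∀ v : (thetaIndex (pilotDataOfK T.D T.K)).V, v ∈ (thetaIndex (pilotDataOfK T.D T.K)).Vbad → Type}
      [∀ v h, Monoid (Mv v h)]
      (sig : GlobalLGPFrobenioidSignature (thetaIndex (pilotDataOfK T.D T.K)).lstar (thetaIndex (pilotDataOfK T.D T.K)).V
        (· ∈ (thetaIndex (pilotDataOfK T.D T.K)).Vbad) Frd IsoF Ob realify Strip IsoS Mv)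
      (split : SplittingMonoids Mv) {ObΔ : Type} {N : ∀ v : (thetaIndex (pilotDataOfK T.D T.K)).V, v ∈ (thetaIndex (pilotDataOfK T.D T.K)).Vbad → Type}
      [∀ v h, Monoid (N v h)] (qData : QPilotData ObΔ N)
      (tq : ∀ (pp : Nat.Primes) (x : (thetaIndex (pilotDataOfK T.D T.K)).Fibre (.inr pp)),
        haveI : Fact (pp : ℕ).Prime := ⟨pp.2⟩; kOf (pilotDataOfK T.D T.K) pp.1 x)
      (t : ∀ (pp : Nat.Primes) (_ : Fin (pilotDataOfK T.D T.K).lstar) (x : (thetaIndex (pilotDataOfK T.D T.K)).Fibre (.inr pp)),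
        haveI : Fact (pp : ℕ).Prime := ⟨pp.2⟩; kOf (pilotDataOfK T.D T.K) pp.1 x)
      (htq0 : ∀ pp x, tq pp x ≠ 0)
      (htq1 : ∀ (pp : Nat.Primes) (x : (thetaIndex (pilotDataOfK T.D T.K)).Fibre (.inr pp)),
        haveI : Fact (pp : ℕ).Prime := ⟨pp.2⟩; placeOf (pilotDataOfK T.D T.K) pp.1 x ∉ (pilotDataOfK T.D T.K).S → ‖tq pp x‖ = 1)
      (col : ℤ → Column (logShellsDH (pilotDataOfK T.D T.K) logv))
      (_ht0 : ∀ pp i x, t pp i x ≠ 0)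
      (_ht : ∀ (pp : Nat.Primes) (i : Fin (pilotDataOfK T.D T.K).lstar) (x : (thetaIndex (pilotDataOfK T.D T.K)).Fibre (.inr pp)),
        haveI : Fact (pp : ℕ).Prime := ⟨pp.2⟩
        Real.log ‖t pp i x‖ = -((pilotDataOfK T.D T.K).thetaPilot i (placeOf (pilotDataOfK T.D T.K) pp.1 x)) *
          logNorm T.K (placeOf (pilotDataOfK T.D T.K) pp.1 x) / localDegree T.K (placeOf (pilotDataOfK T.D T.K) pp.1 x))
      (_htq : ∀ (pp : Nat.Primes) (x : (thetaIndex (pilotDataOfK T.D T.K)).Fibre (.inr pp)),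
        haveI : Fact (pp : ℕ).Prime := ⟨pp.2⟩
        Real.log ‖tq pp x‖ = -((pilotDataOfK T.D T.K).qPilot (placeOf (pilotDataOfK T.D T.K) pp.1 x)) *
          logNorm T.K (placeOf (pilotDataOfK T.D T.K) pp.1 x) / localDegree T.K (placeOf (pilotDataOfK T.D T.K) pp.1 x)),
      ∃ (ρ : (∀ v : (thetaIndex (pilotDataOfK T.D T.K)).V, v ∈ (thetaIndex (pilotDataOfK T.D T.K)).Vbad →
              Set ((logShellsDH (pilotDataOfK T.D T.K) logv).StarPacket v)) →
            ∀ (j : (thetaIndex (pilotDataOfK T.D T.K)).Label) (vQ : (thetaIndex (pilotDataOfK T.D T.K)).VQ),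
              Set ((logShellsDH (pilotDataOfK T.D T.K) logv).Packet j vQ))
          (qK : ∀ v : (thetaIndex (pilotDataOfK T.D T.K)).V, v ∈ (thetaIndex (pilotDataOfK T.D T.K)).Vbad →
            Set ((logShellsDH (pilotDataOfK T.D T.K) logv).StarPacket v)),
          QPinned ({ toSituation := situationPrVol (pilotDataOfK T.D T.K) hlog M archPk archSub Ψ act Mmod region, col := col } :
              LatticeSituation (thetaIndex (pilotDataOfK T.D T.K)))
            (settingPrVolSharp (pilotDataOfK T.D T.K) hlog M archPk archSub Ψ act Mmod region n lat sig split qData tq t htq0 htq1) ρ qK ∧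
          PilotKummerCompatHull ({ toSituation := situationPrVol (pilotDataOfK T.D T.K) hlog M archPk archSub Ψ act Mmod region, col := col } :
              LatticeSituation (thetaIndex (pilotDataOfK T.D T.K)))
            (settingPrVolSharp (pilotDataOfK T.D T.K) hlog M archPk archSub Ψ act Mmod region n lat sig split qData tq t htq0 htq1) ρ qK :=
  WRow.exists_qPinned_and_hull_triple_unconditional habc hj1728 T (fun p => (a * b * c).factorization p / 2)
    (fun p => (a * b * c).factorization p / 2) (WRow.hcell_triple_of_sq_lt habc hl hbig)

/-! ## §1. S_H at EVERY `k ≥ 1` beyond `l² > 16·abc_k` -/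

/-- **«W:HEX-UNIFORM-K» (U1 (i)): for EVERY `k ≥ 1` and EVERY prime `l` with `16·((7^k+4)·(7^k−4)·(2·7^k)) < l²`**, every genuine Θ-volume datum
`T` at `(ratPoint (1/2 + 2/7^k), l)` and every pair of Θ- and q-ideles realising the pilot divisors of `X := pilotDataOfK T.D T.K`: abc-iut-c312-1's
`Thm311ToCor312.Licence` HOLDS at abc-iut-c312-7's `settingPrVolSharp X …` — abc-iut-W-row-1's `WRow.licence_triple_unconditional` at
abc-iut-C-cert-2's `WRow.hcell_triple_of_sq_lt` (envelope exponents `⌊v_p(abc_k)/2⌋`), transported along `lamSeven_eq_hexK`.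
[cite: Mochizuki2012, IUTchI Def. 3.1 (b),(c) pp. 61–62, Ex. 3.2 (iv) p. 71; IUTchIII Cor. 3.12 Step (xi-d) p. 183, (xi-f) p. 184; IUTchIV Prop. 1.2 (i)(ii) p. 10, Prop. 1.4 (ii) p. 13, Cor. 2.2 (ii) proof (P5) p. 46] [cite: DupuyHilado2025, §3.3, §3.4, §4.9, §4.12] [claim: Mochizuki2012, status: disputed] -/
theorem WRow.licence_lamSeven_allK_of_sq_lt {k l : ℕ} (hk : 1 ≤ k) (hl : l.Prime)
    (hbig : 16 * ((7 ^ k + 4) * (7 ^ k - 4) * (2 * 7 ^ k)) < l ^ 2)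
    (T : Cor22.ThetaVolumeDatumAt (ratPoint ((2 : ℚ)⁻¹ + 2 / 7 ^ k)) l) :
    letI := T.instFieldF; letI := T.instNumberFieldF; letI := T.instAlgebraF; letI := T.instFieldK
    letI := T.instNumberFieldK; letI := T.instAlgebraK; letI := T.instFieldFbar; letI := T.instAlgebraFbar
    letI := T.instAlgebraKFbar; letI := T.instIsElliptic
    ∀ {logv : PadicLogs T.K} (hlog : LogvAnalytic logv) (M : Type) [Field M] [NumberField M]
      (archPk : ∀ (j : (thetaIndex (pilotDataOfK T.D T.K)).Label) (vQ : (thetaIndex (pilotDataOfK T.D T.K)).VQ),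
        Set ((logShellsDH (pilotDataOfK T.D T.K) logv).Packet j vQ))
      (archSub : ∀ (j : (thetaIndex (pilotDataOfK T.D T.K)).Label) (v : (thetaIndex (pilotDataOfK T.D T.K)).V),
        Set ((logShellsDH (pilotDataOfK T.D T.K) logv).Packet j ((thetaIndex (pilotDataOfK T.D T.K)).over v)))
      (Ψ : ℤ → ∀ v : (thetaIndex (pilotDataOfK T.D T.K)).V, v ∈ (thetaIndex (pilotDataOfK T.D T.K)).Vbad →
        Set ((logShellsDH (pilotDataOfK T.D T.K) logv).StarPacket v))
      (act : ℤ → ∀ v : (thetaIndex (pilotDataOfK T.D T.K)).V, v ∈ (thetaIndex (pilotDataOfK T.D T.K)).Vbad →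
        (logShellsDH (pilotDataOfK T.D T.K) logv).StarPacket v → Module.End ℚ ((logShellsDH (pilotDataOfK T.D T.K) logv).StarPacket v))
      (Mmod : ℤ → ∀ j : (thetaIndex (pilotDataOfK T.D T.K)).LabelStar, Set ((logShellsDH (pilotDataOfK T.D T.K) logv).GlobalPacket j.1))
      (region : ℤ → ∀ j : (thetaIndex (pilotDataOfK T.D T.K)).LabelStar, FinDivisor M → ∀ vQ : (thetaIndex (pilotDataOfK T.D T.K)).VQ,
        Set ((logShellsDH (pilotDataOfK T.D T.K) logv).Packet j.1 vQ))
      (n : ℤ) {HT : Type} {LogLink : HT → HT → Type} {IsFull : ∀ {s t : HT}, LogLink s t → Prop}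
      (lat : LGPGaussianLogThetaLattice LogLink IsFull)
      {Frd : Type} {IsoF : Frd → Frd → Type} {Ob : Frd → Type} {realify : Frd → Frd} {Strip : Type}
      {IsoS : Strip → Strip → Type} {Mv : ∀ v : (thetaIndex (pilotDataOfK T.D T.K)).V, v ∈ (thetaIndex (pilotDataOfK T.D T.K)).Vbad → Type}
      [∀ v h, Monoid (Mv v h)]
      (sig : GlobalLGPFrobenioidSignature (thetaIndex (pilotDataOfK T.D T.K)).lstar (thetaIndex (pilotDataOfK T.D T.K)).V
        (· ∈ (thetaIndex (pilotDataOfK T.D T.K)).Vbad) Frd IsoF Ob realify Strip IsoS Mv)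
      (split : SplittingMonoids Mv) {ObΔ : Type} {N : ∀ v : (thetaIndex (pilotDataOfK T.D T.K)).V, v ∈ (thetaIndex (pilotDataOfK T.D T.K)).Vbad → Type}
      [∀ v h, Monoid (N v h)] (qData : QPilotData ObΔ N)
      (tq : ∀ (pp : Nat.Primes) (x : (thetaIndex (pilotDataOfK T.D T.K)).Fibre (.inr pp)),
        haveI : Fact (pp : ℕ).Prime := ⟨pp.2⟩; kOf (pilotDataOfK T.D T.K) pp.1 x)
      (t : ∀ (pp : Nat.Primes) (_ : Fin (pilotDataOfK T.D T.K).lstar) (x : (thetaIndex (pilotDataOfK T.D T.K)).Fibre (.inr pp)),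
        haveI : Fact (pp : ℕ).Prime := ⟨pp.2⟩; kOf (pilotDataOfK T.D T.K) pp.1 x)
      (htq0 : ∀ pp x, tq pp x ≠ 0)
      (htq1 : ∀ (pp : Nat.Primes) (x : (thetaIndex (pilotDataOfK T.D T.K)).Fibre (.inr pp)),
        haveI : Fact (pp : ℕ).Prime := ⟨pp.2⟩; placeOf (pilotDataOfK T.D T.K) pp.1 x ∉ (pilotDataOfK T.D T.K).S → ‖tq pp x‖ = 1)
      (_ht0 : ∀ pp i x, t pp i x ≠ 0)
      (_ht : ∀ (pp : Nat.Primes) (i : Fin (pilotDataOfK T.D T.K).lstar) (x : (thetaIndex (pilotDataOfK T.D T.K)).Fibre (.inr pp)),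
        haveI : Fact (pp : ℕ).Prime := ⟨pp.2⟩
        Real.log ‖t pp i x‖ = -((pilotDataOfK T.D T.K).thetaPilot i (placeOf (pilotDataOfK T.D T.K) pp.1 x)) *
          logNorm T.K (placeOf (pilotDataOfK T.D T.K) pp.1 x) / localDegree T.K (placeOf (pilotDataOfK T.D T.K) pp.1 x))
      (_htq : ∀ (pp : Nat.Primes) (x : (thetaIndex (pilotDataOfK T.D T.K)).Fibre (.inr pp)),
        haveI : Fact (pp : ℕ).Prime := ⟨pp.2⟩
        Real.log ‖tq pp x‖ = -((pilotDataOfK T.D T.K).qPilot (placeOf (pilotDataOfK T.D T.K) pp.1 x)) *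
          logNorm T.K (placeOf (pilotDataOfK T.D T.K) pp.1 x) / localDegree T.K (placeOf (pilotDataOfK T.D T.K) pp.1 x)),
      Thm311ToCor312.Licence
        (settingPrVolSharp (pilotDataOfK T.D T.K) hlog M archPk archSub Ψ act Mmod region n lat sig split qData tq t htq0 htq1) := by
  revert T
  rw [lamSeven_eq_hexK k]
  intro T
  exact WRow.licence_triple_of_sq_lt (isABCTriple_hexK hk) (jInv_hexK_ne hk) hl hbig T

/-- **BRANCH C's PER-DATUM ANTECEDENT «∃ ρ qK, QPinned ∧ PilotKummerCompatHull» at every genuine datum over `(ratPoint (1/2 + 2/7^k), l)`, EVERY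
`k ≥ 1`, EVERY prime `l` with `16·abc_k < l²`** (any columns `col`; every pair of realising ideles, the CHOSEN ones of the window certificates
included): `WRow.exists_qPinned_and_hull_triple_unconditional` at `WRow.hcell_triple_of_sq_lt`.
[cite: Mochizuki2012, IUTchIII Cor. 3.12 Step (xi-d) p. 183, (xi-f) p. 184] [cite: DupuyHilado2025, §3.3, §3.4, §4.9] [claim: Mochizuki2012, status: disputed] -/
theorem WRow.exists_qPinned_and_hull_lamSeven_allK_of_sq_lt {k l : ℕ} (hk : 1 ≤ k) (hl : l.Prime)
    (hbig : 16 * ((7 ^ k + 4) * (7 ^ k - 4) * (2 * 7 ^ k)) < l ^ 2)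
    (T : Cor22.ThetaVolumeDatumAt (ratPoint ((2 : ℚ)⁻¹ + 2 / 7 ^ k)) l) :
    letI := T.instFieldF; letI := T.instNumberFieldF; letI := T.instAlgebraF; letI := T.instFieldK
    letI := T.instNumberFieldK; letI := T.instAlgebraK; letI := T.instFieldFbar; letI := T.instAlgebraFbar
    letI := T.instAlgebraKFbar; letI := T.instIsElliptic
    ∀ {logv : PadicLogs T.K} (hlog : LogvAnalytic logv) (M : Type) [Field M] [NumberField M]
      (archPk : ∀ (j : (thetaIndex (pilotDataOfK T.D T.K)).Label) (vQ : (thetaIndex (pilotDataOfK T.D T.K)).VQ),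
        Set ((logShellsDH (pilotDataOfK T.D T.K) logv).Packet j vQ))
      (archSub : ∀ (j : (thetaIndex (pilotDataOfK T.D T.K)).Label) (v : (thetaIndex (pilotDataOfK T.D T.K)).V),
        Set ((logShellsDH (pilotDataOfK T.D T.K) logv).Packet j ((thetaIndex (pilotDataOfK T.D T.K)).over v)))
      (Ψ : ℤ → ∀ v : (thetaIndex (pilotDataOfK T.D T.K)).V, v ∈ (thetaIndex (pilotDataOfK T.D T.K)).Vbad →
        Set ((logShellsDH (pilotDataOfK T.D T.K) logv).StarPacket v))
      (act : ℤ → ∀ v : (thetaIndex (pilotDataOfK T.D T.K)).V, v ∈ (thetaIndex (pilotDataOfK T.D T.K)).Vbad →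
        (logShellsDH (pilotDataOfK T.D T.K) logv).StarPacket v → Module.End ℚ ((logShellsDH (pilotDataOfK T.D T.K) logv).StarPacket v))
      (Mmod : ℤ → ∀ j : (thetaIndex (pilotDataOfK T.D T.K)).LabelStar, Set ((logShellsDH (pilotDataOfK T.D T.K) logv).GlobalPacket j.1))
      (region : ℤ → ∀ j : (thetaIndex (pilotDataOfK T.D T.K)).LabelStar, FinDivisor M → ∀ vQ : (thetaIndex (pilotDataOfK T.D T.K)).VQ,
        Set ((logShellsDH (pilotDataOfK T.D T.K) logv).Packet j.1 vQ))
      (n : ℤ) {HT : Type} {LogLink : HT → HT → Type} {IsFull : ∀ {s t : HT}, LogLink s t → Prop}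
      (lat : LGPGaussianLogThetaLattice LogLink IsFull)
      {Frd : Type} {IsoF : Frd → Frd → Type} {Ob : Frd → Type} {realify : Frd → Frd} {Strip : Type}
      {IsoS : Strip → Strip → Type} {Mv : ∀ v : (thetaIndex (pilotDataOfK T.D T.K)).V, v ∈ (thetaIndex (pilotDataOfK T.D T.K)).Vbad → Type}
      [∀ v h, Monoid (Mv v h)]
      (sig : GlobalLGPFrobenioidSignature (thetaIndex (pilotDataOfK T.D T.K)).lstar (thetaIndex (pilotDataOfK T.D T.K)).V
        (· ∈ (thetaIndex (pilotDataOfK T.D T.K)).Vbad) Frd IsoF Ob realify Strip IsoS Mv)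
      (split : SplittingMonoids Mv) {ObΔ : Type} {N : ∀ v : (thetaIndex (pilotDataOfK T.D T.K)).V, v ∈ (thetaIndex (pilotDataOfK T.D T.K)).Vbad → Type}
      [∀ v h, Monoid (N v h)] (qData : QPilotData ObΔ N)
      (tq : ∀ (pp : Nat.Primes) (x : (thetaIndex (pilotDataOfK T.D T.K)).Fibre (.inr pp)),
        haveI : Fact (pp : ℕ).Prime := ⟨pp.2⟩; kOf (pilotDataOfK T.D T.K) pp.1 x)
      (t : ∀ (pp : Nat.Primes) (_ : Fin (pilotDataOfK T.D T.K).lstar) (x : (thetaIndex (pilotDataOfK T.D T.K)).Fibre (.inr pp)),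
        haveI : Fact (pp : ℕ).Prime := ⟨pp.2⟩; kOf (pilotDataOfK T.D T.K) pp.1 x)
      (htq0 : ∀ pp x, tq pp x ≠ 0)
      (htq1 : ∀ (pp : Nat.Primes) (x : (thetaIndex (pilotDataOfK T.D T.K)).Fibre (.inr pp)),
        haveI : Fact (pp : ℕ).Prime := ⟨pp.2⟩; placeOf (pilotDataOfK T.D T.K) pp.1 x ∉ (pilotDataOfK T.D T.K).S → ‖tq pp x‖ = 1)
      (col : ℤ → Column (logShellsDH (pilotDataOfK T.D T.K) logv))
      (_ht0 : ∀ pp i x, t pp i x ≠ 0)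
      (_ht : ∀ (pp : Nat.Primes) (i : Fin (pilotDataOfK T.D T.K).lstar) (x : (thetaIndex (pilotDataOfK T.D T.K)).Fibre (.inr pp)),
        haveI : Fact (pp : ℕ).Prime := ⟨pp.2⟩
        Real.log ‖t pp i x‖ = -((pilotDataOfK T.D T.K).thetaPilot i (placeOf (pilotDataOfK T.D T.K) pp.1 x)) *
          logNorm T.K (placeOf (pilotDataOfK T.D T.K) pp.1 x) / localDegree T.K (placeOf (pilotDataOfK T.D T.K) pp.1 x))
      (_htq : ∀ (pp : Nat.Primes) (x : (thetaIndex (pilotDataOfK T.D T.K)).Fibre (.inr pp)),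
        haveI : Fact (pp : ℕ).Prime := ⟨pp.2⟩
        Real.log ‖tq pp x‖ = -((pilotDataOfK T.D T.K).qPilot (placeOf (pilotDataOfK T.D T.K) pp.1 x)) *
          logNorm T.K (placeOf (pilotDataOfK T.D T.K) pp.1 x) / localDegree T.K (placeOf (pilotDataOfK T.D T.K) pp.1 x)),
      ∃ (ρ : (∀ v : (thetaIndex (pilotDataOfK T.D T.K)).V, v ∈ (thetaIndex (pilotDataOfK T.D T.K)).Vbad →
              Set ((logShellsDH (pilotDataOfK T.D T.K) logv).StarPacket v)) →
            ∀ (j : (thetaIndex (pilotDataOfK T.D T.K)).Label) (vQ : (thetaIndex (pilotDataOfK T.D T.K)).VQ),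
              Set ((logShellsDH (pilotDataOfK T.D T.K) logv).Packet j vQ))
          (qK : ∀ v : (thetaIndex (pilotDataOfK T.D T.K)).V, v ∈ (thetaIndex (pilotDataOfK T.D T.K)).Vbad →
            Set ((logShellsDH (pilotDataOfK T.D T.K) logv).StarPacket v)),
          QPinned ({ toSituation := situationPrVol (pilotDataOfK T.D T.K) hlog M archPk archSub Ψ act Mmod region, col := col } :
              LatticeSituation (thetaIndex (pilotDataOfK T.D T.K)))
            (settingPrVolSharp (pilotDataOfK T.D T.K) hlog M archPk archSub Ψ act Mmod region n lat sig split qData tq t htq0 htq1) ρ qK ∧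
          PilotKummerCompatHull ({ toSituation := situationPrVol (pilotDataOfK T.D T.K) hlog M archPk archSub Ψ act Mmod region, col := col } :
              LatticeSituation (thetaIndex (pilotDataOfK T.D T.K)))
            (settingPrVolSharp (pilotDataOfK T.D T.K) hlog M archPk archSub Ψ act Mmod region n lat sig split qData tq t htq0 htq1) ρ qK := by
  revert T
  rw [lamSeven_eq_hexK k]
  intro T
  exact WRow.exists_qPinned_and_hull_triple_of_sq_lt (isABCTriple_hexK hk) (jInv_hexK_ne hk) hl hbig T

end Summit.ABC.IUTFork.Conditional

end
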